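import Summits.AtomisticToContinuum.Crystallization.Theses.FluxTubeKepler
import Summits.AtomisticToContinuum.Crystallization.Theses.PhononSlackCertificates
import Summits.AtomisticToContinuum.Crystallization.Theorems.HullMinimalityLayeredWindowsNecessity
import Summits.AtomisticToContinuum.Crystallization.Theorems.PhononSlackCertificatesHullBridgeNonLayeredFraction
import Summits.AtomisticToContinuum.Crystallization.Theorems.FluxTubeKeplerFluxCellKeplerNecessity

/-!
# `FluxCellKepler` (stmt-AtomisticToContinuum-15221), line `Sketch` — the crux implies
# `CoerciveTwoShellGap` (item 13956) at EVERY separation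

`FluxTubeKeplerFluxCellKeplerPricingTwoShellGap.lean` derived the instances `δ ≥ 1/3` of
`PhononSlackCertificates.CoerciveTwoShellGap` from the τ-free defect pricing (the registered stub
`stub_defectPricedExcess` of the line), using the landed window lemma
`LayeredWindowsLocal.isTwoShellGood_of_window` whose separation `1/3` and tolerance `1/200` are fixed.
Here the window lemma is re-run at a variable tolerance `τ₀ ≤ 1/200` with `2 τ₀ < δ` (the ONLY use of the
separation in its proof is that two particles within the tolerance of one site coincide):

* `good_of_sites_tol`, `isTwoShellGood_of_window_tol` — verbatim the landed
  `LayeredWindowsLocal.good_of_sites` / `isTwoShellGood_of_window` with `(1/3, 1/200)` replaced by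
  `(δ, τ₀)`, `2 τ₀ < δ`, `0 ≤ τ₀ ≤ 1/200`;
* `coerciveTwoShellGap_of_defectPricing` — the pricing at scale `(2, min (1/200) (δ/3))` prices every
  non-two-shell-good site, so `stub_defectPricedExcess → CoerciveTwoShellGap` (item 13956 BY NAME);
* `coerciveTwoShellGap_of_fluxCellKepler` — with the landed necessity
  `FluxCellKeplerSketchNec.stub_cruxNecessity`: `FluxCellKepler → CoerciveTwoShellGap`.

Together with `FluxCellKeplerSketchGaps.stub_defectPricedExcess_of_gaps`
(`CoerciveTwoShellGap → NearFieldConvexity → stub_defectPricedExcess`) this sandwiches the τ-free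
content of the crux between the board's items 13956 and 13956 ∧ 13958.
-/

noncomputable section

open scoped BigOperators Classical
open Filter Topology

namespace Summit.AtomisticToContinuum.Crystallization.Theorems.FluxCellKeplerSketchGaps

open Summit.AtomisticToContinuum.Crystallization.Theses
open Summit.AtomisticToContinuum.Crystallization.Theorems.PrestressSplitKorn
open Summit.AtomisticToContinuum.Crystallization.Theorems.HullBridgeExact
open Summit.AtomisticToContinuum.Crystallization.Theorems.LayeredWindowsLocal
open Literature.MathematicalPhysics.StatisticalMechanics Literature.Geometry.DiscreteGeometry
open Summit.AtomisticToContinuum.Crystallization.Theorems.ChargedEnergyGapNegative (E3)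

/-! ## The window lemma at variable tolerance -/

/-- **Goodness from approximate sites, tolerance `τ₀`** (verbatim `LayeredWindowsLocal.good_of_sites`
with the separation `1/3` and the tolerance `1/200` replaced by `δ` and `τ₀`, `2 τ₀ < δ`,
`τ₀ ≤ 1/200`). [folklore] -/
theorem good_of_sites_tol {N : ℕ} {x : Fin N → E3} {δ τ₀ : ℝ} (hτδ : 2 * τ₀ < δ) (hτ1 : τ₀ ≤ 1 / 200)
    (hsep : ∀ i j : Fin N, i ≠ j → δ ≤ dist (x i) (x j))
    {a : ℝ} (ha47 : 47 / 50 ≤ a) (ha1 : a ≤ 1) (F : E3 →ₗᵢ[ℝ] E3) {P : Finset E3}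
    (hP : P = fccTwoShellPattern ∨ P = hcpTwoShellPattern) (site : E3 → E3) (t c₀ : E3) {j : Fin N}
    (hS1 : ∀ v ∈ P, ∃ i : Fin N, dist (x i + t) (site v) ≤ τ₀)
    (hS2 : ∀ v ∈ P, dist (site v) (c₀ + a • F v) ≤ 37 / 1000 * a)
    (hS3 : dist (x j + t) c₀ ≤ τ₀)
    (hS4 : ∀ j' : Fin N, j' ≠ j → dist (x j') (x j) ≤ 3 / 2 * a →
      ∃ v ∈ P, dist (x j' + t) (site v) ≤ τ₀) :
    IsTwoShellGood (1 / 20) (47 / 50) 1 x j := by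
  classical
  have ha : 0 < a := by linarith
  -- the assignment
  have hf0 : ∀ v : E3, ∃ i : Fin N, v ∈ P → dist (x i + t) (site v) ≤ τ₀ := by
    intro v
    by_cases hv : v ∈ P
    · obtain ⟨i, hi⟩ := hS1 v hv
      exact ⟨i, fun _ => hi⟩
    · exact ⟨j, fun h => absurd h hv⟩
  choose f hf using hf0
  -- norms of pattern vectors and separation of the pattern
  have hnorm : ∀ v ∈ P, 1 ≤ ‖v‖ := by
    intro v hv
    have h2 : (1 : ℝ) ≤ Real.sqrt 2 := Real.one_le_sqrt.mpr (by norm_num)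
    rcases hP with rfl | rfl
    · rcases norm_of_mem_fccTwoShellPattern hv with h | h
      · rw [h]
      · rw [h]; exact h2
    · rcases norm_of_mem_hcpTwoShellPattern hv with h | h
      · rw [h]
      · rw [h]; exact h2
  have hpsep : ∀ v ∈ P, ∀ v' ∈ P, v ≠ v' → 1 ≤ dist v v' := by
    intro v hv v' hv' hne
    rcases hP with rfl | rfl
    · exact one_le_dist_of_mem_fccTwoShellPattern hv hv' hne
    · exact one_le_dist_of_mem_hcpTwoShellPattern hv hv' hne
  -- two particles within `1/200` of one point coincide
  have hsame : ∀ (i i' : Fin N) (p : E3), dist (x i + t) p ≤ τ₀ → dist (x i' + t) p ≤ τ₀ → i = i' := by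
    intro i i' p hi hi'
    by_contra hne
    have h1 := hsep i i' hne
    have h2 : dist (x i) (x i') ≤ τ₀ + τ₀ := by
      calc dist (x i) (x i') = dist (x i + t) (x i' + t) := by rw [dist_add_right]
        _ ≤ dist (x i + t) p + dist (x i' + t) p := dist_triangle_right _ _ _
        _ ≤ τ₀ + τ₀ := add_le_add hi hi'
    linarith
  refine ⟨a, ha47, ha1, F, P, f, hP, ?_, ?_, ?_⟩
  · -- closeness and `f v ≠ j`
    intro v hv
    have hfv := hf v hv
    have hsv := hS2 v hv
    constructor
    · -- `f v ≠ j`: the site is far from `c₀`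
      intro heq
      have hFv : ‖a • F v‖ = a * ‖v‖ := by rw [norm_smul, LinearIsometry.norm_map, Real.norm_of_nonneg ha.le]
      have h1 : a ≤ ‖a • F v‖ := by
        rw [hFv]; nlinarith [hnorm v hv]
      have h2 : ‖a • F v‖ ≤ dist (x j + t) (site v) + dist (site v) (c₀ + a • F v) + dist (x j + t) c₀ := by
        have e : a • F v = (c₀ + a • F v) - c₀ := by abel
        calc ‖a • F v‖ = dist (c₀ + a • F v) c₀ := by rw [dist_eq_norm, add_sub_cancel_left]
          _ ≤ dist (c₀ + a • F v) (x j + t) + dist (x j + t) c₀ := dist_triangle _ _ _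
          _ ≤ (dist (x j + t) (site v) + dist (site v) (c₀ + a • F v)) + dist (x j + t) c₀ := by
              gcongr; rw [dist_comm]; exact dist_triangle _ _ _
      rw [heq] at hfv
      linarith
    · -- closeness `≤ a/20`
      calc dist (x (f v)) (x j + a • F v)
          = dist (x (f v) + t) (x j + t + a • F v) := by
              rw [show x j + t + a • F v = (x j + a • F v) + t by abel, dist_add_right]
        _ ≤ dist (x (f v) + t) (site v) + dist (site v) (c₀ + a • F v) + dist (c₀ + a • F v) (x j + t + a • F v) :=
              dist_triangle4 _ _ _ _
        _ = dist (x (f v) + t) (site v) + dist (site v) (c₀ + a • F v) + dist c₀ (x j + t) := by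
              rw [dist_add_right]
        _ ≤ τ₀ + 37 / 1000 * a + τ₀ := by rw [dist_comm c₀]; gcongr
        _ ≤ 1 / 20 * a := by linarith
  · -- injectivity on the pattern
    intro v hv v' hv' hvv'
    by_contra hne
    have hd : 1 ≤ dist v v' := hpsep v hv v' hv' hne
    have hFd : dist (a • F v) (a • F v') = a * dist v v' := by
      rw [dist_eq_norm, ← smul_sub, norm_smul, ← map_sub, LinearIsometry.norm_map, Real.norm_of_nonneg ha.le,
        ← dist_eq_norm]
    have h1 : a ≤ dist (a • F v) (a • F v') := by rw [hFd]; nlinarith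
    have h2 : dist (a • F v) (a • F v') ≤ dist (site v) (c₀ + a • F v) + dist (site v') (c₀ + a • F v') +
        (dist (x (f v) + t) (site v) + dist (x (f v') + t) (site v')) := by
      have e1 : dist (a • F v) (a • F v') = dist (c₀ + a • F v) (c₀ + a • F v') := by rw [dist_add_left]
      rw [e1]
      calc dist (c₀ + a • F v) (c₀ + a • F v')
          ≤ dist (c₀ + a • F v) (site v) + dist (site v) (site v') + dist (site v') (c₀ + a • F v') :=
            dist_triangle4 _ _ _ _
        _ ≤ dist (c₀ + a • F v) (site v) + (dist (site v) (x (f v) + t) + dist (x (f v) + t) (site v')) +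
              dist (site v') (c₀ + a • F v') := by gcongr; exact dist_triangle _ _ _
        _ = dist (site v) (c₀ + a • F v) + dist (site v') (c₀ + a • F v') +
              (dist (x (f v) + t) (site v) + dist (x (f v') + t) (site v')) := by
            rw [dist_comm (c₀ + a • F v), dist_comm (site v) (x (f v) + t), hvv']; ring
    have := hS2 v hv
    have := hS2 v' hv'
    have := hf v hv
    have := hf v' hv'
    linarith
  · -- two-way: every other particle within `3a/2` is assigned
    intro j' hj' hd
    obtain ⟨v, hv, hv'⟩ := hS4 j' hj' hd
    exact ⟨v, hv, hsame _ _ _ (hf v hv) hv'⟩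

/-- **Inside a window every particle is two-shell good, tolerance `τ₀`** (verbatim
`LayeredWindowsLocal.isTwoShellGood_of_window` with `(1/3, 1/200)` replaced by `(δ, τ₀)`, `2 τ₀ < δ`,
`τ₀ ≤ 1/200`): a `δ`-separated `x` two-way `τ₀`-matched on `B(0, R)`, after the translation `t`,
with the rigid image of a box template has every particle `j` with `‖x j + t‖ + 2 ≤ R` two-shell good.
[folklore] -/
theorem isTwoShellGood_of_window_tol {N : ℕ} {x : Fin N → E3} {δ τ₀ : ℝ} (hτδ : 2 * τ₀ < δ) (hτ1 : τ₀ ≤ 1 / 200)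
    (hsep : ∀ i j : Fin N, i ≠ j → δ ≤ dist (x i) (x j))
    {A : E3 →ₗᵢ[ℝ] E3} {t : E3} {a : ℝ} {s : ℤ → ℤ} {z : ℤ → ℝ}
    (hbox : InBox a z) (hs : IsHaggSeq s) {R : ℝ}
    (h1 : ∀ p ∈ Set.range (fun l : ℤ × ℤ × ℤ => A (layeredPos a s z l)), ‖p‖ ≤ R →
      ∃ i : Fin N, dist (x i + t) p ≤ τ₀)
    (h2 : ∀ i : Fin N, ‖x i + t‖ ≤ R →
      ∃ p ∈ Set.range (fun l : ℤ × ℤ × ℤ => A (layeredPos a s z l)), dist (x i + t) p ≤ τ₀)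
    {j : Fin N} (hj : ‖x j + t‖ + 2 ≤ R) :
    IsTwoShellGood (1 / 20) (47 / 50) 1 x j := by
  have ha47 := hbox.1
  have ha1 := hbox.2.1
  have ha := hbox.a_pos
  -- the site of `j`
  obtain ⟨_, ⟨l₀, rfl⟩, hd₀⟩ := h2 j (by linarith)
  dsimp only at hd₀
  set p₀ : E3 := A (layeredPos a s z l₀) with hp₀
  -- the re-based template
  have hbox' := hbox.shift l₀.1
  have hsh := isHaggSeq_shift hs l₀.1
  have hshift := layeredPos_shift a s z l₀
  have hz0 : (fun k => z (k + l₀.1) - z l₀.1) 0 = 0 := by simp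
  generalize (fun k => s (k + l₀.1)) = s' at hbox' hsh hshift hz0
  generalize (fun k => z (k + l₀.1) - z l₀.1) = z' at hbox' hsh hshift hz0
  -- `S = p₀ + A (template')`
  have hmem : ∀ q : ℤ × ℤ × ℤ, p₀ + A (layeredPos a s' z' q) ∈
      Set.range (fun l : ℤ × ℤ × ℤ => A (layeredPos a s z l)) := by
    intro q
    refine ⟨q + l₀, ?_⟩
    simp only [hp₀, hshift q, map_sub]
    abel
  have hrepr : ∀ l : ℤ × ℤ × ℤ, A (layeredPos a s z l) = p₀ + A (layeredPos a s' z' (l - l₀)) := by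
    intro l
    have := hshift (l - l₀)
    rw [sub_add_cancel] at this
    rw [this, map_sub, hp₀]
    abel
  -- the frame and the labelled ideal sites of the re-based word
  obtain ⟨F, P, lab, hP, hideal, hlab1, hsurj⟩ := exists_frame_sites hsh ha47 ha1
  -- the actual sites
  refine good_of_sites_tol hτδ hτ1 hsep ha47 ha1 (A.comp F) hP (fun v => p₀ + A (layeredPos a s' z' (lab v))) t p₀
    ?_ ?_ hd₀ ?_
  · -- (S1) every site is an `S`-point in the window, hence carries a particle
    intro v hv
    refine h1 _ (hmem (lab v)) ?_
    have hq := hlab1 v hv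
    have hn1 : ‖layeredPos a s' z' (lab v)‖ ≤ ‖layeredPos a s' (idealZ a) (lab v)‖ + 37 / 1000 * a := by
      have := dist_site_ideal_le (s := s') hbox' hz0 hq
      rw [dist_eq_norm] at this
      calc ‖layeredPos a s' z' (lab v)‖
          = ‖(layeredPos a s' z' (lab v) - layeredPos a s' (idealZ a) (lab v)) + layeredPos a s' (idealZ a) (lab v)‖ := by
              rw [sub_add_cancel]
        _ ≤ ‖layeredPos a s' z' (lab v) - layeredPos a s' (idealZ a) (lab v)‖ + ‖layeredPos a s' (idealZ a) (lab v)‖ :=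
              norm_add_le _ _
        _ ≤ _ := by linarith
    have hn2 : ‖layeredPos a s' (idealZ a) (lab v)‖ ≤ Real.sqrt 2 * a := by
      rw [← hideal v hv, norm_smul, LinearIsometry.norm_map, Real.norm_of_nonneg ha.le]
      have := norm_le_sqrt_two_of_mem_twoShellPattern hP hv
      nlinarith
    have hs2 : Real.sqrt 2 ≤ 1.415 := by
      rw [Real.sqrt_le_left (by norm_num)]; norm_num
    have hs2a : Real.sqrt 2 * a ≤ 1.415 * a := mul_le_mul_of_nonneg_right hs2 ha.le
    have hp₀n : ‖p₀‖ ≤ ‖x j + t‖ + τ₀ := by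
      calc ‖p₀‖ = dist p₀ 0 := (dist_zero_right _).symm
        _ ≤ dist p₀ (x j + t) + dist (x j + t) 0 := dist_triangle _ _ _
        _ = dist (x j + t) p₀ + ‖x j + t‖ := by rw [dist_comm, dist_zero_right]
        _ ≤ _ := by linarith
    calc ‖p₀ + A (layeredPos a s' z' (lab v))‖ ≤ ‖p₀‖ + ‖A (layeredPos a s' z' (lab v))‖ := norm_add_le _ _
      _ = ‖p₀‖ + ‖layeredPos a s' z' (lab v)‖ := by rw [A.norm_map (layeredPos a s' z' (lab v))]
      _ ≤ R := by linarith
  · -- (S2) actual versus ideal site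
    intro v hv
    have := dist_site_ideal_le (s := s') hbox' hz0 (hlab1 v hv)
    rw [dist_add_left]
    show dist (A (layeredPos a s' z' (lab v))) (a • A (F v)) ≤ 37 / 1000 * a
    rwa [← A.map_smul, hideal v hv, LinearIsometry.dist_map]
  · -- (S4) every other particle within `3a/2` of `x j` sits at a site
    intro j' hj' hd
    have hj'R : ‖x j' + t‖ ≤ R := by
      calc ‖x j' + t‖ = dist (x j' + t) 0 := (dist_zero_right _).symm
        _ ≤ dist (x j' + t) (x j + t) + dist (x j + t) 0 := dist_triangle _ _ _
        _ = dist (x j') (x j) + ‖x j + t‖ := by rw [dist_add_right, dist_zero_right]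
        _ ≤ R := by nlinarith
    obtain ⟨_, ⟨l', rfl⟩, hd'⟩ := h2 j' hj'R
    dsimp only at hd'
    set q' : ℤ × ℤ × ℤ := l' - l₀ with hq'
    have hp' : A (layeredPos a s z l') = p₀ + A (layeredPos a s' z' q') := hrepr l'
    rw [hp'] at hd'
    -- `q'` is a nonzero site of norm `≤ 38a/25`
    have hq'0 : q' ≠ 0 := by
      intro h0
      have hz00 : layeredPos a s' z' 0 = 0 := by
        have := hshift 0
        rw [zero_add, sub_self] at this
        exact this
      rw [h0, hz00, map_zero, add_zero] at hd'
      have : j' = j := by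
        by_contra hne
        have h1 := hsep j' j hne
        have h2 : dist (x j') (x j) ≤ τ₀ + τ₀ := by
          calc dist (x j') (x j) = dist (x j' + t) (x j + t) := by rw [dist_add_right]
            _ ≤ dist (x j' + t) p₀ + dist (x j + t) p₀ := dist_triangle_right _ _ _
            _ ≤ _ := add_le_add hd' hd₀
        linarith
      exact hj' this
    have hq'n : ‖layeredPos a s' z' q'‖ ≤ 38 / 25 * a := by
      have e : ‖layeredPos a s' z' q'‖ = dist (p₀ + A (layeredPos a s' z' q')) p₀ := by
        rw [dist_eq_norm, add_sub_cancel_left, LinearIsometry.norm_map]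
      rw [e]
      calc dist (p₀ + A (layeredPos a s' z' q')) p₀
          ≤ dist (p₀ + A (layeredPos a s' z' q')) (x j' + t) + dist (x j' + t) (x j + t) + dist (x j + t) p₀ :=
            dist_triangle4 _ _ _ _
        _ = dist (x j' + t) (p₀ + A (layeredPos a s' z' q')) + dist (x j') (x j) + dist (x j + t) p₀ := by
            rw [dist_comm, dist_add_right]
        _ ≤ τ₀ + 3 / 2 * a + τ₀ := by gcongr
        _ ≤ 38 / 25 * a := by linarith
    have hcls := site_class_two hbox' hsh hz0 hq'0 hq'n
    obtain ⟨v, hv, hlv⟩ := hsurj q' hcls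
    refine ⟨v, hv, ?_⟩
    show dist (x j' + t) (p₀ + A (layeredPos a s' z' (lab v))) ≤ τ₀
    rw [hlv]
    exact hd'

/-! ## The coercive two-shell gap from the pricing, at every separation -/

/-- **`stub_defectPricedExcess → CoerciveTwoShellGap`** (item stmt-AtomisticToContinuum-13956, by
name): given `δ > 0`, price the `(2, min (1/200) (δ/3))`-layered-bad sites with the constant
`c = c(δ, 2, min (1/200) (δ/3))` of the pricing; a `(2, min (1/200) (δ/3))`-layered-good site of a
`δ`-separated configuration is two-shell good (`isTwoShellGood_of_window_tol` with `t = −x i`,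
`2 τ₀ ≤ 2δ/3 < δ`), so `g := c` works. [folklore] -/
theorem coerciveTwoShellGap_of_defectPricing : (∀ δ : ℝ, 0 < δ → ∀ R η : ℝ, 0 < R → 0 < η → ∃ c : ℝ, 0 < c ∧ ∀ (N : ℕ) (x : Fin N → EuclideanSpace ℝ (Fin 3)), Function.Injective x → (∀ i j, i ≠ j → δ ≤ dist (x i) (x j)) → c * (Nat.card {i : Fin N // ¬ ∃ a : ℝ, 47 / 50 ≤ a ∧ a ≤ 1 ∧ ∃ (A : EuclideanSpace ℝ (Fin 3) →ₗᵢ[ℝ] EuclideanSpace ℝ (Fin 3)) (s : ℤ → ℤ) (z : ℤ → ℝ), IsHaggSeq s ∧ (∀ m : ℤ, 39 / 50 * a ≤ z (m + 1) - z m ∧ z (m + 1) - z m ≤ 17 / 20 * a) ∧ let S : Set (EuclideanSpace ℝ (Fin 3)) := {p | ∃ m k l : ℤ, p = A (((k : ℝ) • triangularVec₁ a) + ((l : ℝ) • triangularVec₂ a) + ((haggLabel s m : ℝ) • barlowOffset a) + (z m • layerNormal 1))}; (∀ p ∈ S, ‖p‖ ≤ R → ∃ j : Fin N, dist (x j - x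 i) p ≤ η) ∧ (∀ j : Fin N, ‖x j - x i‖ ≤ R → ∃ p ∈ S, dist (x j - x i) p ≤ η)} : ℝ) ≤ interactionEnergy lennardJones x - (N : ℝ) * ⨅ Q : PeriodicConfiguration 3, Q.energyPerParticle lennardJones) → Summit.AtomisticToContinuum.Crystallization.Theses.PhononSlackCertificates.CoerciveTwoShellGap := by
  intro h₂ δ hδ
  have hτ0 : (0 : ℝ) < min (1 / 200) (δ / 3) := lt_min (by norm_num) (by linarith)
  obtain ⟨c, hc, hcb⟩ := h₂ δ hδ 2 (min (1 / 200) (δ / 3)) two_pos hτ0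
  refine ⟨c, hc, fun N x hsep => ?_⟩
  have hx : Function.Injective x := by
    intro i j hij
    by_contra hne
    have := hsep i j hne
    rw [hij, dist_self] at this
    linarith
  have hτδ : 2 * min (1 / 200) (δ / 3) < δ := by
    have := min_le_right (1 / 200 : ℝ) (δ / 3)
    linarith
  have hτ1 : min (1 / 200) (δ / 3) ≤ 1 / 200 := min_le_left _ _
  have key := hcb N x hx hsep
  have hle : Nat.card {i : Fin N // ¬ IsTwoShellGood (1 / 20) (47 / 50) 1 x i} ≤
      Nat.card {i : Fin N // ¬ ∃ a : ℝ, 47 / 50 ≤ a ∧ a ≤ 1 ∧ ∃ (A : EuclideanSpace ℝ (Fin 3) →ₗᵢ[ℝ] EuclideanSpace ℝ (Fin 3)) (s : ℤ → ℤ) (z : ℤ → ℝ), IsHaggSeq s ∧ (∀ m : ℤ, 39 / 50 * a ≤ z (m + 1) - z m ∧ z (m + 1) - z m ≤ 17 / 20 * a) ∧ let S : Set (EuclideanSpace ℝ (Fin 3)) := {p | ∃ m k l : ℤ, p = A (((k : ℝ) • triangularVec₁ a) + ((l : ℝ) • triangularVec₂ a) + ((haggLabel s m : ℝ) • barlowOffset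 a) + (z m • layerNormal 1))}; (∀ p ∈ S, ‖p‖ ≤ 2 → ∃ j : Fin N, dist (x j - x i) p ≤ min (1 / 200) (δ / 3)) ∧ (∀ j : Fin N, ‖x j - x i‖ ≤ 2 → ∃ p ∈ S, dist (x j - x i) p ≤ min (1 / 200) (δ / 3))} := by
    rw [Nat.card_eq_fintype_card, Nat.card_eq_fintype_card]
    refine Fintype.card_subtype_mono _ _ fun i hi hgood => hi ?_
    obtain ⟨a, ha1, ha2, A, s, z, hs, hz, h12⟩ := hgood
    dsimp only at h12
    rw [nl_setOf_eq_range A a s z] at h12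
    obtain ⟨h1, h2⟩ := h12
    have hbox : InBox a z := ⟨ha1, ha2, hz⟩
    refine isTwoShellGood_of_window_tol (A := A) (t := -x i) (R := 2) hτδ hτ1 hsep hbox hs
      ?_ ?_ (by simp)
    · intro p hp hpR
      obtain ⟨j, hj⟩ := h1 p hp hpR
      exact ⟨j, by rwa [← sub_eq_add_neg]⟩
    · intro j hj
      rw [← sub_eq_add_neg] at hj ⊢
      exact h2 j hj
  have hle' : (Nat.card {i : Fin N // ¬ IsTwoShellGood (1 / 20) (47 / 50) 1 x i} : ℝ) ≤
      (Nat.card {i : Fin N // ¬ ∃ a : ℝ, 47 / 50 ≤ a ∧ a ≤ 1 ∧ ∃ (A : EuclideanSpace ℝ (Fin 3) →ₗᵢ[ℝ] EuclideanSpace ℝ (Fin 3)) (s : ℤ → ℤ) (z : ℤ → ℝ), IsHaggSeq s ∧ (∀ m : ℤ, 39 / 50 * a ≤ z (m + 1) - z m ∧ z (m + 1) - z m ≤ 17 / 20 * a) ∧ let S : Set (EuclideanSpace ℝ (Fin 3)) := {p | ∃ m k l : ℤ, p = A (((k : ℝ) • triangularVec₁ a) + ((l : ℝ) • triangularVec₂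 a) + ((haggLabel s m : ℝ) • barlowOffset a) + (z m • layerNormal 1))}; (∀ p ∈ S, ‖p‖ ≤ 2 → ∃ j : Fin N, dist (x j - x i) p ≤ min (1 / 200) (δ / 3)) ∧ (∀ j : Fin N, ‖x j - x i‖ ≤ 2 → ∃ p ∈ S, dist (x j - x i) p ≤ min (1 / 200) (δ / 3))} : ℝ) := by
    exact_mod_cast hle
  nlinarith [mul_le_mul_of_nonneg_left hle' hc.le]

/-- **`FluxCellKepler → CoerciveTwoShellGap`**: the crux (item 15221) implies item 13956 of route
`PhononSlackCertificates`, through the landed necessity `FluxCellKeplerSketchNec.stub_cruxNecessity`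
(crux ⇒ τ-free pricing) and `coerciveTwoShellGap_of_defectPricing`.  A refutation of 13956 refutes the
crux. [folklore] -/
theorem coerciveTwoShellGap_of_fluxCellKepler : Summit.AtomisticToContinuum.Crystallization.Theses.FluxTubeKepler.FluxCellKepler → Summit.AtomisticToContinuum.Crystallization.Theses.PhononSlackCertificates.CoerciveTwoShellGap :=
  fun hX => coerciveTwoShellGap_of_defectPricing
    (Summit.AtomisticToContinuum.Crystallization.Theorems.FluxCellKeplerSketchNec.stub_cruxNecessity hX).2

end Summit.AtomisticToContinuum.Crystallization.Theorems.FluxCellKeplerSketchGaps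

end
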